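import Literature.Computability.AlgebraicComplexity.IK2020CormainLemmaProofs
import Literature.Computability.AlgebraicComplexity.IK2020BlockWordStabilizer
import HarnessLib

/-!
# Ikenmeyer–Kandasamy 2020, Lemma 5.2 now rests on Thm. 4.2 alone

Topic `Literature/Computability/AlgebraicComplexity` (val-lit cell, row IK20-A). Theorems only.

Source: C. Ikenmeyer, U. Kandasamy, arXiv:1911.03990 [IkenmeyerKandasamy2019], Lemma 5.2 and its
proof (TeX L528–535; held text `paper:arxiv-1911.03990` p0010.txt:L13–35): "Let `Ξ` denote the set
of all partitions `ϱ ⊢_m d`. Using Theorem 4.2, then according to Proposition 4.1 we have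
`mult_{(λ+(m×e_Ξ D))^*} ℂ[\overline{Gp}] ≥ mult_{λ^*} ℂ[Gp]`. Using Lemma 5.1 … It remains to show
that `e_Ξ = e`." The tree had this printed proof as the reduction
`IK2020_lemma_5_2_of_thm_4_2_of_prop_10_1 : IK2020_thm_4_2 → IK2020_prop_10_1 → IK2020_lemma_5_2`
(val-lit t08 g2). Since Prop. 10.1 is now a theorem (`IK2020_prop_10_1_holds`, val-lit U1, seven
seats, `IK2020BlockWordStabilizer.lean`), the named fact `IK2020_lemma_5_2` depends on the single
named fact `IK2020_thm_4_2` (the Main Technical Theorem): `IK2020_lemma_5_2_of_thm_4_2`.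

Honest framing: bookkeeping of IK's toy model `x₁^D + ⋯ + x_m^D`; nothing here bears on VP versus
VNP, which is NOT proved.

## References

* [IkenmeyerKandasamy2019] C. Ikenmeyer, U. Kandasamy, arXiv:1911.03990, Lemma 5.2 (proof),
  Prop. 4.1, Prop. 10.1, Thm. 4.2.
-/

namespace Literature.Computability.AlgebraicComplexity

/-- **IK 2020 Lemma 5.2 from Thm. 4.2 alone** (the printed proof, TeX L528–535, with Prop. 10.1 —
hence Prop. 4.1 — discharged in the tree: `IK2020_prop_10_1_holds`).
[cite: IkenmeyerKandasamy2019, Lemma 5.2 (proof)] -/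
theorem IK2020_lemma_5_2_of_thm_4_2 (h42 : IK2020_thm_4_2) : IK2020_lemma_5_2 :=
  IK2020_lemma_5_2_of_thm_4_2_of_prop_10_1 h42 IK2020_prop_10_1_holds

end Literature.Computability.AlgebraicComplexity
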